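import Mathlib
import HarnessLib
import Summits.HubbardSuperconductivity.HubbardSuperconductivity.Theorems.KLProgrammeKLRegimeSplitGlue
import Summits.HubbardSuperconductivity.HubbardSuperconductivity.Theorems.KLProgrammeKLRegimeSplitGenericV2
import Summits.HubbardSuperconductivity.HubbardSuperconductivity.Theorems.KLProgrammeKLRegimeSplitPredicatesV5

/-!
# Route `KLProgramme` — the K3-NAMED glue of the split at the RESTAGED children and the V5 bundle `klPredsV5` (the ONE bundle of record)
# (stmt-HubbardSuperconductivity-19937; DOWNSTREAM of the route file; cell gate-hubbard-kl, seat p2, g4)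

`KLRegimeInductionP2 (Pr)`: the restaged generic children `EngineP2 | BetaSplitP | CountertermP2 | TwoPointAssemblyP Pr klWindowC`
(`…SplitGenericV2`, `R` chosen before `Q` — Δ8) give crux K3 `Theses.KLProgramme.KLRegimeTwoPointLimit` BY NAME for every bundle
(`k3_twoPointLimit_of_childrenP2` + the route's S0 theorem `MuOfDopingWindow_holds`), and `KLRegimeInductionV5` is its specialisation
to `klPredsV5` (`…SplitPredicatesV4`: V3's split/engine, p2's renormalisation v2 and Fermi-curve-read two-leg step — Δ9/Δ10) = the
`--glue-by` declaration of the K3 split edit whose children of record are `EngineP2 klPredsV5 klWindowC`,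
`BetaSplitP klPredsV5 klWindowC`, `CountertermP2 klPredsV5 klWindowC`, `TwoPointAssemblyP klPredsV5 klWindowC`.  Nothing else is
asserted.
-/

noncomputable section

namespace Summit.HubbardSuperconductivity.HubbardSuperconductivity.Theorems.KLRegimeSplit

set_option linter.dupNamespace false -- summit = problem name (single-conjunct summit), D-0017

/-- **The K3-named glue for the restaged children, every bundle**: `EngineP2`, `BetaSplitP`, `CountertermP2`, `TwoPointAssemblyP`
at `Pr` on the covariance window imply crux K3 `KLRegimeTwoPointLimit` BY NAME (strong induction on the scale index with the constant
staging `G → P → R → Q → (c₀, c₁) → U₀`, then S0 `MuOfDopingWindow_holds`). -/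
theorem KLRegimeInductionP2 (Pr : Preds) (h₃ : EngineP2 Pr klWindowC) (h₁ : BetaSplitP Pr klWindowC)
    (h₂ : CountertermP2 Pr klWindowC) (h₄ : TwoPointAssemblyP Pr klWindowC) :
    Summit.HubbardSuperconductivity.HubbardSuperconductivity.Theses.KLProgramme.KLRegimeTwoPointLimit :=
  k3_twoPointLimit_of_childrenP2 h₃ h₁ h₂ h₄
    Summit.HubbardSuperconductivity.HubbardSuperconductivity.Theses.KLProgramme.MuOfDopingWindow_holds

/-- **The K3-named glue at the V5 bundle (the bundle of record)**: the four V4 children of record imply crux K3 `KLRegimeTwoPointLimit` BY NAME. -/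
theorem KLRegimeInductionV5 :
    EngineP2 klPredsV5 klWindowC → BetaSplitP klPredsV5 klWindowC → CountertermP2 klPredsV5 klWindowC →
      TwoPointAssemblyP klPredsV5 klWindowC →
        Summit.HubbardSuperconductivity.HubbardSuperconductivity.Theses.KLProgramme.KLRegimeTwoPointLimit :=
  KLRegimeInductionP2 klPredsV5

end Summit.HubbardSuperconductivity.HubbardSuperconductivity.Theorems.KLRegimeSplit

end
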